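import Literature.Computability.AlgebraicComplexity.PerDetHwvCertificateSemantics
import HarnessLib

/-!
# Determinant-side kernel certificates: points of the orbit of `det_m`

Lean checker of the GCT multiplicity-obstruction engine (cell `pub-gct`, bundle
papers/PneNP/gct-obstructions; honest framing of that cell: rung-1 multiplicity-obstruction search
for permanent versus determinant at small `(n, m)`; no claim about VP ≠ VNP or P ≠ NP is made here
or there). The files `PerDetHwvCertificate*.lean` certify LOWER bounds
`r ≤ mult_{λ^*} k[Δ(X₀₀^{m-n} per_n)]` on the PERMANENT side from an `r × r` minor of tableau
highest-weight vectors evaluated at points `g · (X₀₀^{m-n} per_n)`. This file is the same checker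
for the DETERMINANT side: the point of a `m² × m²` integer matrix `g` is `g · det_m`, read as the
signed sum of `m!` products of `m` linear forms (`detPoint`), and a verified certificate gives

  `Cert.le_orbitMultiplicity_det : c.r ≤ mult_{λ^*} K[Δ(det_m)]` (`orbitMultiplicity K (detFormLex K m) m λ^*`)

over every field `K` of characteristic `0` (`Cert.verifyDet`, `Cert.canonical`, `c.n = c.m`). Use in
the cell: a kernel-checked `1 ≤ mult_{λ^*} ℂ[Δ(det₃)]_d` makes "`λ` is NOT an occurrence obstruction"
(Dörfler–Ikenmeyer–Panova 2020 §2) a kernel fact for the strict rows of the cell's table, and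
`r_det ≤ mult` complements the engines' upper bound `mult ≤ sk(λ, m × d)` (BLMW 2011 Prop. 5.2.1,
tree theorem `orbitMultiplicity_det_le_symKroneckerCoeffRect`).

Contents. §1 `detPoint` and its naturality; §2 the det-side verifier `Cert.verifyDet` (same
`Cert` record, same structural checks, entries recomputed at `detPoint`); §3 glue (`verifyDet ⇒`
nonsingular integer minor); §4 the hypothesis structure `SemanticsDet` and the rank bound; §5 the
form presented by `detPoint m g` is `(liftMat g · renameMat ρ) · det_m` (Leibniz formula, signs via
`sgn_decide_sign`); §6 the semantics discharged and the unconditional theorem. Everything is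
[folklore] bookkeeping over the cited evaluation-rank principle (Bürgisser–Ikenmeyer 2013 §4;
Dörfler–Ikenmeyer–Panova 2020 §5: tree theorem
`le_orbitMultiplicity_of_det_eval_ne_zero_of_mem_orbitClosure`).
-/

noncomputable section

open scoped BigOperators

namespace Literature.Computability.AlgebraicComplexity

namespace TableauEval

open MvPolynomial
open _root_.Literature.NumberTheory.DiophantineGeometry

/-! ## §1 The determinant after a linear substitution, as a signed sum of products of linear forms -/

section PointOfMatrix

variable {R : Type*} [CommRing R]

/-- **The point `g · det_m`** as the signed sum of `m!` products of `m` linear forms: for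
`σ ∈ S_m` the coefficient is `sgn σ` and the forms are the columns `i·m + σ i` of `g` (`i < m`).
Variables of `det_m`: `x_{i,j} ↦ i m + j`; action `X_v ↦ ∑_w g_{w v} X_w`. [folklore] -/
def detPoint (m : ℕ) (g : List (List R)) : Point R :=
  ⟨(permsSign (List.range m)).map fun σ =>
    (sgn σ.1, (List.range m).map fun i => colOf g (i * m + σ.2.getD i 0))⟩

/-- Every term of `detPoint m g` has exactly `m` linear forms. [folklore] -/
theorem length_forms_detPoint (m : ℕ) (g : List (List R)) (t : Fin (detPoint m g).terms.length) :
    ((detPoint m g).terms.get t).2.length = m := by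
  unfold detPoint at t ⊢
  rw [List.get_eq_getElem, List.getElem_map]
  simp only [List.length_map, List.length_range]

variable {S : Type*} [CommRing S] (f : R →+* S)

/-- The determinant point commutes with ring maps. [folklore] -/
theorem detPoint_map (m : ℕ) (g : List (List R)) :
    detPoint m (g.map fun row => row.map f) = (detPoint m g).map f := by
  unfold detPoint Point.map
  simp only [List.map_map]
  congr 1
  refine List.map_congr_left fun σ _ => ?_
  simp only [Function.comp_apply, map_sgn, List.map_map, colOf_map, Function.comp_def]

end PointOfMatrix

/-! ## §2 The det-side verifier (same certificate record) -/

namespace Cert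

/-- The `j`-th point, read as `g_j · det_m`, reduced mod `p`. [folklore] -/
def pointModDet (c : Cert) (p : ℕ) (j : ℕ) : Point (ZMod p) :=
  detPoint c.m (matCast (c.points.getD j []))

/-- The recomputed det-side entry `F_i(g_j · det_m) mod p`. [folklore] -/
def entryDet (c : Cert) (p : ℕ) (i j : ℕ) : ZMod p :=
  evalC (c.pointModDet p j) (c.hwvs.getD i ⟨0, 0, []⟩)

/-- The recomputed det-side minor mod `p`. [folklore] -/
def minorDet (c : Cert) (p : ℕ) : List (List (ZMod p)) :=
  c.rows.map fun i => c.cols.map fun j => c.entryDet p i j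

/-- Det-side arithmetic checks modulo the `π`-th modulus: recomputed entries agree with the claimed
ones and the minor's `detL` is nonzero. [folklore] -/
def arithDet (c : Cert) (π : ℕ) (p : ℕ) : Bool :=
  let M := c.minorDet p
  let cl := c.claimed.getD π []
  (List.zipWith (fun row crow => List.zipWith (fun (x : ZMod p) (y : ℕ) => decide (x = (y : ZMod p)))
      row crow |>.all id) M cl).all id
  && (cl.length == c.r) && (cl.all fun crow => crow.length == c.r)
  && decide (detL c.r M ≠ 0)

/-- Det-side arithmetic checks for all listed moduli. [folklore] -/
def arithAllDet (c : Cert) : List ℕ → ℕ → Bool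
  | [], _ => true
  | p :: ps, π => c.arithDet π p && c.arithAllDet ps (π + 1)

/-- **The det-side verifier**: the structural checks of `Cert.structural`, `n = m` (the generator
is `det_m` itself in its `m²` variables), and the det-side arithmetic checks. [folklore] -/
def verifyDet (c : Cert) : Bool :=
  c.structural && (c.n == c.m) && !c.primes.isEmpty && c.arithAllDet c.primes 0

/-- The INTEGER det-side value of network `i` at point `j`. [folklore] -/
def evalIntDet (c : Cert) (i j : ℕ) : ℤ :=
  evalC (detPoint c.m (c.points.getD j [])) (c.hwvs.getD i ⟨0, 0, []⟩)

/-- The mod-`p` det-side entry is the reduction of `evalIntDet`. [folklore] -/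
theorem entryDet_eq_cast_evalIntDet (c : Cert) (p : ℕ) (i j : ℕ) :
    c.entryDet p i j = (Int.castRingHom (ZMod p)) (c.evalIntDet i j) := by
  unfold entryDet pointModDet evalIntDet
  rw [← evalC_map, ← detPoint_map, ← matCast_map (Int.castRingHom (ZMod p)), matCast_int]

/-! ## §3 From `verifyDet = true` to a nonsingular integer minor -/

/-- `verifyDet = true` gives the structural checks. [folklore] -/
theorem structural_of_verifyDet (c : Cert) (h : c.verifyDet = true) : c.structural = true := by
  simp only [verifyDet, Bool.and_eq_true] at h
  exact h.1.1.1

/-- `verifyDet = true` gives `n = m`. [folklore] -/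
theorem n_eq_m_of_verifyDet (c : Cert) (h : c.verifyDet = true) : c.n = c.m := by
  simp only [verifyDet, Bool.and_eq_true, beq_iff_eq] at h
  exact h.1.1.2

/-- `verifyDet = true` gives a first modulus whose det-side arithmetic checks pass. [folklore] -/
theorem exists_arithDet_of_verifyDet (c : Cert) (h : c.verifyDet = true) :
    ∃ p ps, c.primes = p :: ps ∧ c.arithDet 0 p = true := by
  simp only [verifyDet, Bool.and_eq_true, Bool.not_eq_true', List.isEmpty_eq_false_iff,
    ne_eq] at h
  obtain ⟨⟨-, hne⟩, hall⟩ := h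
  match hp : c.primes with
  | [] => exact absurd hp hne
  | p :: ps =>
    rw [hp, arithAllDet, Bool.and_eq_true] at hall
    exact ⟨p, ps, rfl, hall.1⟩

/-- The det-side arithmetic check gives a nonzero list determinant. [folklore] -/
theorem detL_minorDet_ne_zero_of_arithDet (c : Cert) {π p : ℕ} (h : c.arithDet π p = true) :
    detL c.r (c.minorDet p) ≠ 0 := by
  simp only [arithDet, Bool.and_eq_true, decide_eq_true_eq] at h
  exact h.2

/-- The positivity of the parts of `λ` from `verifyDet`. [folklore] -/
theorem lam_pos_of_verifyDet (c : Cert) (h : c.verifyDet = true) : ∀ a ∈ c.lam, 0 < a :=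
  (c.spec_of_structural (c.structural_of_verifyDet h)).2.2.2.2.1

/-- `λ ⊢ m·d` from `verifyDet`. [folklore] -/
theorem lam_sum_of_verifyDet (c : Cert) (h : c.verifyDet = true) : c.lam.sum = c.m * c.d :=
  (c.spec_of_structural (c.structural_of_verifyDet h)).2.2.2.1

/-- Entries of the recomputed det-side minor inside the range. [folklore] -/
theorem getD_minorDet (c : Cert) (p : ℕ) {a b : ℕ} (ha : a < c.rows.length) (hb : b < c.cols.length) :
    ((c.minorDet p).getD a []).getD b 0 = c.entryDet p (c.rows.getD a 0) (c.cols.getD b 0) := by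
  have h1 : (c.minorDet p).getD a [] = c.cols.map fun j => c.entryDet p (c.rows.getD a 0) j := by
    unfold minorDet
    rw [List.getD_eq_getElem _ _ (by simpa using ha), List.getElem_map,
      List.getD_eq_getElem _ _ ha]
  rw [h1, List.getD_eq_getElem _ _ (by simpa using hb), List.getElem_map,
    List.getD_eq_getElem _ _ hb]

/-- The integer det-side evaluation matrix of the minor. [folklore] -/
def intMinorDet (c : Cert) : Matrix (Fin c.r) (Fin c.r) ℤ :=
  Matrix.of fun a b => c.evalIntDet (c.rows.getD a 0) (c.cols.getD b 0)

/-- `verifyDet = true` makes the integer det-side evaluation matrix nonsingular. [folklore] -/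
theorem det_intMinorDet_ne_zero (c : Cert) (h : c.verifyDet = true) : c.intMinorDet.det ≠ 0 := by
  obtain ⟨p, ps, -, harith⟩ := c.exists_arithDet_of_verifyDet h
  have hS := c.spec_of_structural (c.structural_of_verifyDet h)
  have hrc : c.rows.length = c.cols.length := hS.2.2.2.2.2.1
  have hne := c.detL_minorDet_ne_zero_of_arithDet harith
  have hmat : matOfRows c.r (c.minorDet p) = (Int.castRingHom (ZMod p)).mapMatrix c.intMinorDet := by
    ext a b
    rw [matOfRows, Matrix.of_apply, c.getD_minorDet p a.isLt (by rw [← hrc]; exact b.isLt),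
      RingHom.mapMatrix_apply,
      Matrix.map_apply, intMinorDet, Matrix.of_apply, entryDet_eq_cast_evalIntDet]
  have hlen : (c.minorDet p).length = c.r := by simp [minorDet, r]
  have hrows : ∀ row ∈ c.minorDet p, row.length = c.r := by
    intro row hrow
    obtain ⟨i, -, rfl⟩ := List.mem_map.mp hrow
    simp [r, hrc]
  rw [detL_eq_det c.r (c.minorDet p) hlen hrows, hmat, ← RingHom.map_det] at hne
  exact fun h0 => hne (by rw [h0, map_zero])

/-! ## §4 The hypothesis structure and the rank bound -/

/-- **Det-side semantics of a certificate** over a field `K` for a weight `χ`: polynomial functions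
`F i` on `Sym^m (K^{m×m})`, `B`-semi-invariant of weight `χ` for the rows of the minor, and matrices
`γ j` for its columns, whose evaluations `F_i(γ_j · det_m)` are the integers `c.evalIntDet i j`.
[folklore] -/
structure SemanticsDet (c : Cert) [NeZero c.m] (K : Type) [Field K] (χ : Weight (MatIdx c.m)) where
  /-- the polynomial function on forms attached to network `i` -/
  F : ℕ → MvPolynomial (DegIdx (MatIdx c.m) c.m) K
  /-- rows of the minor are `B`-semi-invariants of weight `χ` -/
  mem : ∀ i ∈ c.rows, F i ∈ highestWeightSpace (coordRep (MatIdx c.m) K c.m) χ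
  /-- the matrix attached to point `j` -/
  γ : ℕ → Matrix (MatIdx c.m) (MatIdx c.m) K
  /-- the evaluator computes `F_i (γ_j · det_m)` -/
  eval_eq : ∀ i ∈ c.rows, ∀ j ∈ c.cols,
    aeval (formCoeff c.m (linSubst (MatIdx c.m) K (γ j) (detFormLex K c.m))) (F i) =
      (c.evalIntDet i j : K)

/-- `det_m` (lexicographic matrix variables) is a nonzero polynomial. [folklore] -/
theorem detFormLex_ne_zero' (K : Type) [Field K] (m : ℕ) : detFormLex K m ≠ 0 := by
  rw [detFormLex, Ne, ← map_zero (rename (toLex : Fin m × Fin m → MatIdx m)),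
    (rename_injective _ toLex.injective).eq_iff]
  exact Matrix.det_mvPolynomialX_ne_zero (Fin m) K

/-- **Det-side lower bound from a verified certificate** (conditional on `SemanticsDet`): over a
field `K` of characteristic zero, `c.r ≤ mult_χ K[Δ(det_m)]`. [folklore] -/
theorem le_orbitMultiplicity_det_of_verifyDet (c : Cert) [NeZero c.m] {K : Type} [Field K] [CharZero K]
    {χ : Weight (MatIdx c.m)} (S : c.SemanticsDet K χ) (h : c.verifyDet = true) :
    c.r ≤ orbitMultiplicity K (detFormLex K c.m) c.m χ := by
  haveI : Infinite K := CharZero.infinite K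
  have hS := c.spec_of_structural (c.structural_of_verifyDet h)
  have hrc : c.rows.length = c.cols.length := hS.2.2.2.2.2.1
  have hm : c.m ≠ 0 := (NeZero.ne c.m)
  let F' : Fin c.r → MvPolynomial (DegIdx (MatIdx c.m) c.m) K := fun a => S.F (c.rows.getD a 0)
  let q' : Fin c.r → MvPolynomial (MatIdx c.m) K := fun b =>
    linSubst (MatIdx c.m) K (S.γ (c.cols.getD b 0)) (detFormLex K c.m)
  have hq' : ∀ b, q' b ∈ orbitClosure (detFormLex K c.m) := fun b =>
    linSubst_mem_orbitClosure _ _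
  have hrow_mem : ∀ a : Fin c.r, c.rows.getD a 0 ∈ c.rows := fun a => by
    rw [List.getD_eq_getElem _ _ a.isLt]; exact List.getElem_mem _
  have hcol_mem : ∀ b : Fin c.r, c.cols.getD b 0 ∈ c.cols := fun b => by
    rw [List.getD_eq_getElem _ _ (by rw [← hrc]; exact b.isLt)]; exact List.getElem_mem _
  have hF' : ∀ a, F' a ∈ highestWeightSpace (coordRep (MatIdx c.m) K c.m) χ :=
    fun a => S.mem _ (hrow_mem a)
  have hM : (Matrix.of fun a b => aeval (formCoeff c.m (q' b)) (F' a)) =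
      (Int.castRingHom K).mapMatrix c.intMinorDet := by
    ext a b
    rw [Matrix.of_apply, RingHom.mapMatrix_apply, Matrix.map_apply, intMinorDet, Matrix.of_apply,
      S.eval_eq _ (hrow_mem a) _ (hcol_mem b), eq_intCast]
  have hdet : (Matrix.of fun a b => aeval (formCoeff c.m (q' b)) (F' a)).det ≠ 0 := by
    rw [hM, ← RingHom.map_det, eq_intCast, Int.cast_ne_zero]
    exact c.det_intMinorDet_ne_zero h
  exact le_orbitMultiplicity_of_det_eval_ne_zero_of_mem_orbitClosure hm
    (detFormLex_isHomogeneous K c.m) (detFormLex_ne_zero' K c.m) F' hF' q' hq' hdet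

end Cert

/-! ## §5 The form presented by a determinant point -/

section DetForm

variable (K : Type*) [Field K]
variable (m : ℕ) [NeZero m]

/-- **The determinant in certificate variables**: `det (X_{x(i m + j)})_{i,j<m}`. [folklore] -/
def detPolyX : MvPolynomial (MatIdx m) K :=
  (Matrix.of fun i j : Fin m => (X ((matIdxEnum m).x ((i : ℕ) * m + j)) :
    MvPolynomial (MatIdx m) K)).det

variable {m}

omit [NeZero m] in
/-- With `n = m` the certificate index of the tree variable `(a, b)` is `a·m + b`. [folklore] -/
theorem certIdx_self (v : MatIdx m) :
    certIdx m m v = ((ofLex v).1 : ℕ) * m + ((ofLex v).2 : ℕ) := by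
  unfold certIdx
  rw [Nat.sub_self, if_pos ⟨Nat.zero_le _, Nat.zero_le _⟩, Nat.sub_zero, Nat.sub_zero]

/-- **The relabelled tree determinant is the certificate determinant**:
`rename ρ det_m = det (X_{x(i m + j)})`. [folklore] -/
theorem rename_rho_detFormLex :
    rename (rho m m) (detFormLex K m) = detPolyX K m := by
  unfold detFormLex detPoly detPolyX
  rw [rename_rename, AlgHom.map_det]
  congr 1
  ext i j
  simp only [AlgHom.mapMatrix_apply, Matrix.map_apply, Matrix.mvPolynomialX_apply, rename_X,
    Function.comp_apply, Matrix.of_apply]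
  unfold rho
  rw [certIdx_self, ofLex_toLex]

/-- The product of the linear forms of the term of `π` of `detPoint m g`, read through the
enumeration, is the substitution instance of the corresponding monomial. [folklore] -/
theorem prod_linForm_term_det (g : List (List K)) (π : Equiv.Perm (Fin m)) :
    (∏ s : Fin m, linForm fun v =>
        ((((List.range m).map fun i =>
            colOf g (i * m + (List.ofFn fun r => ((π r : Fin m) : ℕ)).getD i 0)).getD s []).getD
          ((matIdxEnum m).xinv v) 0)) =
      linSubst (MatIdx m) K (liftMat K m g) (∏ i : Fin m, X ((matIdxEnum m).x ((i : ℕ) * m + π i))) := by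
  set forms := (List.range m).map fun i =>
    colOf g (i * m + (List.ofFn fun r => ((π r : Fin m) : ℕ)).getD i 0) with hforms
  have hlen : forms.length = m := by
    rw [hforms, List.length_map, List.length_range]
  have hprod : (∏ s : Fin m, linForm fun v => ((forms.getD s []).getD ((matIdxEnum m).xinv v) 0)) =
      (forms.map fun f => linForm fun v => f.getD ((matIdxEnum m).xinv v) 0).prod := by
    rw [prod_map_eq_prod_get]
    exact Fintype.prod_equiv (finCongr hlen.symm) _ _ fun s => by
      rw [List.getD_eq_getElem _ _ (by rw [hlen]; exact s.isLt)]; rfl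
  rw [hprod, hforms, List.map_map, map_prod, range_eq_ofFn, List.map_ofFn, List.prod_ofFn]
  refine Finset.prod_congr rfl fun i _ => ?_
  have hgi : (List.ofFn fun r => ((π r : Fin m) : ℕ)).getD i 0 = π i := by
    rw [List.getD_eq_getElem _ _ (by simp), List.getElem_ofFn]
  simp only [Function.comp_apply, hgi]
  exact linForm_col K g (mul_add_lt_sq i.isLt (π i).isLt le_rfl)

/-- **The form presented by a determinant point**: reading `detPoint m g` through `coefM`/`formM`
presents `linSubst (liftMat m g) (detPolyX K m)` (Leibniz formula; the sign bit of `permsSign` is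
`sign π` by `sgn_decide_sign`). [folklore] -/
theorem splfPoly_detPoint (g : List (List K)) :
    splfPoly (coefM (detPoint m g)) (formM (matIdxEnum m) (detPoint m g) m) =
      linSubst (MatIdx m) K (liftMat K m g) (detPolyX K m) := by
  have h1 : splfPoly (coefM (detPoint m g)) (formM (matIdxEnum m) (detPoint m g) m)
      = ((detPoint m g).terms.map fun t => C t.1 *
          ∏ s : Fin m, linForm fun v => ((t.2.getD s []).getD ((matIdxEnum m).xinv v) 0)).sum := by
    unfold splfPoly coefM formM
    rw [sum_map_eq_sum_get]
  rw [h1]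
  unfold detPoint
  rw [List.map_map, sum_permsSign_range]
  trans ∑ π : Equiv.Perm (Fin m), linSubst (MatIdx m) K (liftMat K m g)
      (C ((Equiv.Perm.sign π : ℤ) : K) * ∏ i : Fin m, X ((matIdxEnum m).x ((i : ℕ) * m + π i)))
  · refine Finset.sum_congr rfl fun π _ => ?_
    simp only [Function.comp_apply]
    rw [sgn_decide_sign, map_mul, linSubst_C, prod_linForm_term_det K g π]
  · rw [← map_sum, detPolyX, ← Matrix.det_transpose, Matrix.det_apply']
    congr 1

/-- **Determinant points are substitution instances of the tree's determinant**: the presented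
form is `linSubst (liftMat m g * renameMat ρ) (detFormLex K m)`. [folklore] -/
theorem splfPoly_detPoint_eq_linSubst (g : List (List K)) :
    splfPoly (coefM (detPoint m g)) (formM (matIdxEnum m) (detPoint m g) m) =
      linSubst (MatIdx m) K (liftMat K m g * renameMat K (rho m m)) (detFormLex K m) := by
  rw [splfPoly_detPoint K g, linSubst_mul, AlgHom.comp_apply, linSubst_renameMat,
    rename_rho_detFormLex K]

end DetForm

/-! ## §6 The semantics discharged; the unconditional det-side theorem -/

namespace Cert

variable {K : Type} [Field K] [CharZero K]

omit [CharZero K] in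
/-- The integer det-side entry, cast to `K`, is the `K`-evaluation of the `K`-point. [folklore] -/
theorem cast_evalIntDet (c : Cert) (i j : ℕ) :
    ((c.evalIntDet i j : ℤ) : K) =
      evalC (detPoint c.m (matCast (R := K) (c.points.getD j [])))
        (c.hwvs.getD i ⟨0, 0, []⟩) := by
  rw [← matCast_map (Int.castRingHom K), matCast_int, detPoint_map, evalC_map,
    eq_intCast]
  rfl

/-- **The det-side semantics of a verified canonical certificate**: tableau polynomials on the
largest matrix variables, points `liftMat g_j * renameMat ρ` acting on `det_m`. [folklore] -/
theorem semanticsDet (c : Cert) [NeZero c.m] (h : c.verifyDet = true) (hcan : c.canonical = true)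
    (hpos : ∀ a ∈ c.lam, 0 < a) (hsum : c.lam.sum = c.m * c.d) :
    Nonempty (c.SemanticsDet K (c.weight hpos hsum)) := by
  classical
  haveI : Infinite K := CharZero.infinite K
  have hst := c.structural_of_verifyDet h
  have hS := c.spec_of_structural hst
  have hS2 := c.spec2_of_structural hst
  have hcan' : ∀ N ∈ c.hwvs, ∀ col ∈ N.cols, col.vars = List.range col.labels.length := by
    simpa only [canonical, List.all_eq_true, beq_iff_eq] using hcan
  have hmem : ∀ {i : ℕ}, i < c.hwvs.length → c.hwvs.getD i ⟨0, 0, []⟩ ∈ c.hwvs := fun hi => by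
    rw [List.getD_eq_getElem _ _ hi]; exact List.getElem_mem _
  have hcanI : ∀ {i : ℕ}, i < c.hwvs.length → ∀ cl ∈ (c.net i).cols,
      cl.vars = List.range cl.labels.length := fun hi cl hcl => hcan' _ (hmem hi) cl hcl
  set E := matIdxEnum c.m with hE
  -- frames, data, polynomials
  let frame : ∀ i, i < c.hwvs.length → NetFrame (c.net i) := fun i hi =>
    NetFrame.ofCounts _ (c.net_spec hst hi).1 (c.net_spec hst hi).2.1 (c.net_spec hst hi).2.2.1
  let τ : ∀ i, i < c.hwvs.length → TabM (MatIdx c.m) := fun i hi =>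
    TabM.ofNetwork E (c.net i) (frame i hi)
  let F : ℕ → MvPolynomial (DegIdx (MatIdx c.m) c.m) K := fun i =>
    if hi : i < c.hwvs.length then (τ i hi).tabPoly K else 0
  let γ : ℕ → Matrix (MatIdx c.m) (MatIdx c.m) K := fun j =>
    liftMat K c.m (matCast (R := K) (c.points.getD j [])) * renameMat K (rho c.m c.m)
  -- the weight at the enumerated variables
  have hχ : ∀ {i : ℕ} (hi : i < c.hwvs.length), ∀ v, v < c.m * c.m →
      c.weight hpos hsum (E.x v) =
        -((Finset.univ.filter fun col : Fin (c.net i).cols.length =>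
            v < ((c.net i).cols.get col).vars.length).card : ℤ) := by
    intro i hi v hv
    rw [weight, hE, dualOfPartition_toMatIdx_x c.m _ v hv,
      sortedParts_eq_of_isChain (c.lamPartition hpos hsum) c.lam rfl hS2.1,
      card_filter_height_eq (c.net i) c.lam (c.net_spec hst hi).2.2.2 (c.net_spec hst hi).1 v]
  refine ⟨⟨F, ?_, γ, ?_⟩⟩
  · -- highest-weight property
    intro i hrow
    have hi : i < c.hwvs.length := hS.2.2.2.2.2.2.1 i hrow
    show F i ∈ _
    simp only [F, dif_pos hi]
    refine (τ i hi).tabPoly_mem_highestWeightSpace (TabM.frameOfNetwork E _ _)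
      (isAntitoneEnum_matIdx c.m) (fun col => ?_) (fun col r => ?_) _ (fun v hv => hχ hi v hv)
    · -- heights ≤ m²
      show ((c.net i).cols.get col).vars.length ≤ c.m * c.m
      rw [(c.net_spec hst hi).1 _ (List.get_mem _ _)]
      exact le_trans (height_le_length _ _ (c.net_spec hst hi).2.2.2 col) hS.2.2.1
    · -- alternator variables are `x r`
      show E.x (((c.net i).cols.get col).vars.get r) = E.x r
      rw [get_vars_of_canonical _ (hcanI hi _ (List.get_mem _ _))]
  · -- evaluation
    intro i hrow j hcol
    have hi : i < c.hwvs.length := hS.2.2.2.2.2.2.1 i hrow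
    -- alternator variables are `< m²`
    have hvars : ∀ cl ∈ (c.net i).cols, ∀ v ∈ cl.vars, v < c.m * c.m := by
      intro cl hcl v hv
      rw [hcanI hi cl hcl, List.mem_range] at hv
      obtain ⟨col, rfl⟩ := List.mem_iff_get.mp hcl
      exact lt_of_lt_of_le hv (le_trans (height_le_length _ _ (c.net_spec hst hi).2.2.2 col) hS.2.2.1)
    set Pj := detPoint c.m (matCast (R := K) (c.points.getD j [])) with hPj
    have key : aeval (formCoeff c.m (splfPoly (coefM Pj) (formM E Pj c.m))) ((τ i hi).tabPoly K) =
        evalC Pj (c.net i) := by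
      have h1 : aeval (formCoeff c.m (splfPoly (coefM Pj) (formM E Pj c.m))) ((τ i hi).tabPoly K) =
          (τ i hi).EC (coefM Pj) (formM E Pj c.m) :=
        (τ i hi).aeval_formCoeff_tabPoly (K := K) (coefM Pj) (formM E Pj c.m)
      have h2 : (τ i hi).EC (coefM Pj) (formM E Pj c.m) = evalC Pj (c.net i) :=
        TabM.EC_ofNetwork E Pj (c.net i) (frame i hi) (length_forms_detPoint c.m _)
          (c.net_spec hst hi).1 hvars (c.net_spec hst hi).2.1 (c.net_spec hst hi).2.2.1
      exact h1.trans h2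
    show aeval _ (F i) = _
    simp only [F, dif_pos hi, γ]
    rw [← splfPoly_detPoint_eq_linSubst K, ← hE, key, c.net_eq hst hi, cast_evalIntDet]

/-- **Det-side lower bound from a verified canonical certificate, unconditionally**:
`c.r ≤ mult_{λ^*} K[Δ(det_m)]` over any field of characteristic zero — the number of independent
copies of `V_{λ^*}` in the degree-`d` coordinate ring of the orbit closure of `det_m` is at least
the size of the certificate's nonsingular minor. [folklore] -/
theorem le_orbitMultiplicity_det (c : Cert) [NeZero c.m] (h : c.verifyDet = true)
    (hcan : c.canonical = true) :
    c.r ≤ orbitMultiplicity K (detFormLex K c.m) c.m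
      (c.weight (c.lam_pos_of_verifyDet h) (c.lam_sum_of_verifyDet h)) := by
  obtain ⟨S⟩ := c.semanticsDet (K := K) h hcan (c.lam_pos_of_verifyDet h) (c.lam_sum_of_verifyDet h)
  exact c.le_orbitMultiplicity_det_of_verifyDet S h

/-- **Not an occurrence obstruction, det side**: a verified det-side certificate (so `c.r ≥ 1`)
makes `λ^*` OCCUR in `K[Δ(det_m)]_d`: `0 < mult_{λ^*} K[Δ(det_m)]`. [folklore] -/
theorem orbitMultiplicity_det_pos (c : Cert) [NeZero c.m] (h : c.verifyDet = true)
    (hcan : c.canonical = true) :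
    0 < orbitMultiplicity K (detFormLex K c.m) c.m
      (c.weight (c.lam_pos_of_verifyDet h) (c.lam_sum_of_verifyDet h)) := by
  have hS := c.spec_of_structural (c.structural_of_verifyDet h)
  exact lt_of_lt_of_le (lt_of_le_of_lt (Nat.zero_le _) hS.2.2.2.2.2.2.2.2)
    (c.le_orbitMultiplicity_det (K := K) h hcan)

end Cert

/-! ## §7 A toy det-side certificate, checked by the kernel -/

/-- Toy det-side certificate at `(n, m, d, λ) = (2, 2, 2, (2,2))` (the network of `toyCert`: two
columns of height `2` alternating over the variables `0, 1`, i.e. `8 ×` the `2 × 2` Gram minor of a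
quadratic form on the coordinates `0, 1`), one point `g` (so the form is `g · det₂ =
ℓ₀ℓ₃ - ℓ₁ℓ₂` with `ℓ_v = ∑_w g_{wv} y_w`), moduli `101, 103`; the value is `-56 ≡ 45 (101) ≡ 47
(103)` (python mirror `lmdp.py`; the permanent point of the same `g` gives `-104`). Hence
`1 ≤ mult_{(2,2)^*} K[Δ(det₂)]` by `Cert.le_orbitMultiplicity_det` — illustrative only. [folklore] -/
def toyDetCert : Cert where
  n := 2
  m := 2
  d := 2
  lam := [2, 2]
  hwvs := [⟨2, 2, [⟨[0, 1], [0, 1]⟩, ⟨[0, 1], [0, 1]⟩]⟩]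
  points := [[[1, 2, 0, 1], [0, 1, 3, 2], [2, 0, 1, 1], [1, 1, 1, 2]]]
  primes := [101, 103]
  rows := [0]
  cols := [0]
  claimed := [[[45]], [[47]]]
  sk := 0

/-- The toy det-side certificate passes the det-side verifier (kernel evaluation). [folklore] -/
theorem toyDetCert_verifyDet : toyDetCert.verifyDet = true := by
  decide +kernel

/-- The toy certificate is canonical. [folklore] -/
theorem toyDetCert_canonical : toyDetCert.canonical = true := by
  decide +kernel

/-- **`(2,2)^*` occurs in `ℂ[Δ(det₂)]₂`** — the toy instance of `Cert.le_orbitMultiplicity_det`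
(of course `Δ(det₂) = Sym² ℂ⁴`, so this is no news; it exercises the det-side pipeline end to end
in the kernel). [folklore] -/
theorem toyDetCert_bound :
    haveI : NeZero toyDetCert.m := ⟨by decide⟩
    toyDetCert.r ≤ orbitMultiplicity ℂ (detFormLex ℂ toyDetCert.m) toyDetCert.m
      (toyDetCert.weight (toyDetCert.lam_pos_of_verifyDet toyDetCert_verifyDet)
        (toyDetCert.lam_sum_of_verifyDet toyDetCert_verifyDet)) :=
  haveI : NeZero toyDetCert.m := ⟨by decide⟩
  toyDetCert.le_orbitMultiplicity_det toyDetCert_verifyDet toyDetCert_canonical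

end TableauEval

end Literature.Computability.AlgebraicComplexity

end
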